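import Literature.Analysis.FluidPDE.LocalEnergyInitialLEI
import Literature.Analysis.FluidPDE.NSSuitableESSProofs
import Literature.Analysis.FluidPDE.NSSereginMildStabilityTools
import Literature.Analysis.FluidPDE.DistributionalPressurePoisson
import Literature.Analysis.FluidPDE.SuitableWeakExhaustion
import Literature.Analysis.FluidPDE.LeraySeparationOfEnergyTools
import HarnessLib

/-!
# The zero extension of a local energy solution to negative times
(inputs of the initial-time Caffarelli–Kohn–Nirenberg induction; towards Barker–Prange 2020, Thm. 1)

Analysis/FluidPDE proofs file (theorems only, no definitions, no named facts) on the discharge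
path of the named fact `Literature.Analysis.FluidPDE.BarkerPrange2020_thm2`
(`BarkerPrangeConcentration.lean`; T. Barker, C. Prange, Arch. Ration. Mech. Anal. 236 (2020) =
arXiv:1812.09115, Thm. 2). The initial-time induction (`InitialTimeCKNStep2/Step3/Induction.lean`,
see the module docstring of `InitialTimeCKNStep3.lean` for the road taken) is run for a triple
`(U, P, G̃)` on a unit cylinder `Q_1(z₀)` meeting `{t = 0}` which has every property of a
suitable pair except that its local energy inequality carries the datum term `∫ |u₀|² φ(0, ·)`.
This file produces that triple from a local energy solution `(v, π)` on `ℝ³ × (0, T)`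
(Seregin 2014, Def. B.1: `IsLocalEnergySolutionOn T ν v₀ v π`) — it is the **extension by zero
outside the time interval `(0, T)`** of `(v, π, ∇v)` — and verifies:

* `BarkerPrange2020.setIntegral_slab_eq_zero_of_forall_time_cutoff` — the exhaustion lemma:
  an integrable `F` on the slab with `∫∫ η(t) F = 0` for all smooth `η` compactly supported in
  `(0, T)` has `∫∫_{(0,T)×ℝ³} F = 0` (cut-offs `η_k ↑ 1_{(0,T)}`, dominated convergence); through
  it every identity *without time derivatives* passes from tests on the open slab to arbitrary
  tests, i.e. to the zero extension:
* `BarkerPrange2020.hasWeakSpatialGradientOn_extension` — `G̃` is the weak spatial gradient of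
  `U` on all of space–time;
* `BarkerPrange2020.integral_inner_gradient_extension_eq_zero` — `div U = 0` against every test;
* `BarkerPrange2020.pressureEq_extension` — `-ΔP = ∂ᵢ∂ⱼ(UᵢUⱼ)` against every test;
* `BarkerPrange2020.localEnergyIneq_datum_extension` — the local energy inequality of `(U, P, G̃)`
  **with the datum term** for every nonnegative test supported in `{t < T}` (this one does see
  the time derivative: it is Seregin's inequality (B.1.10) from `t₀ = 0`, the accepted
  `IsLocalEnergySolutionOn.localEnergyIneq_initial`, rewritten for the extension);
* the classes: local integrability of `U`, `|U|²`, `G̃`, `|G̃|²`, `P` on space–time (the gauge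
  invariance of Seregin's class under `π ↦ π - c(t)`, `c ∈ L^{3/2}(0, T)`, is the accepted
  `IsLocalEnergySolutionOn.sub_timeGauge`, `LocalEnergySliceE3.lean`).

## References

* T. Barker, C. Prange, Arch. Ration. Mech. Anal. 236 (2020) = arXiv:1812.09115, Thm. 1, §4.
  [BarkerPrange2020]
* G. Seregin, *Lecture Notes on Regularity Theory for the Navier–Stokes Equations* (2014),
  Def. B.1, Remark B.3 (B.1.10). [Seregin2014]
* L. Caffarelli, R. Kohn, L. Nirenberg, Comm. Pure Appl. Math. 35 (1982), §2.
-/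

noncomputable section

open MeasureTheory Set Function Filter Topology TopologicalSpace Metric
open scoped NNReal ENNReal InnerProductSpace RealInnerProductSpace Laplacian

namespace Literature.Analysis.FluidPDE

namespace BarkerPrange2020

/-! ### Time cut-offs exhausting `(0, T)` -/

section Cutoff

/-- **Smooth plateau cut-offs exhausting `(0, T)`.** For `0 < T` there are smooth `η_k : ℝ → ℝ`
with `0 ≤ η_k ≤ 1`, `tsupport η_k ⊆ (0, T)` compact, and `η_k(t) → 1` for every `t ∈ (0, T)`
(indeed `η_k = 1` on `[3δ_k, T - 3δ_k]`, `δ_k ↓ 0`). [folklore] -/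
theorem exists_plateau_cutoffs {T : ℝ} (hT : 0 < T) :
    ∃ η : ℕ → ℝ → ℝ, (∀ k, ContDiff ℝ (⊤ : ℕ∞) (η k)) ∧ (∀ k, HasCompactSupport (η k)) ∧
      (∀ k, tsupport (η k) ⊆ Ioo 0 T) ∧ (∀ k t, 0 ≤ η k t ∧ η k t ≤ 1) ∧
      (∀ t ∈ Ioo 0 T, Tendsto (fun k => η k t) atTop (𝓝 1)) := by
  set δ : ℕ → ℝ := fun k => T / (8 * ((k : ℝ) + 1)) with hδ
  have hδ0 : ∀ k, 0 < δ k := fun k => by positivity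
  have hδT : ∀ k, 8 * δ k ≤ T := fun k => by
    have hk : (1 : ℝ) ≤ (k : ℝ) + 1 := by
      have : (0 : ℝ) ≤ k := Nat.cast_nonneg k
      linarith
    have : T / (8 * ((k : ℝ) + 1)) ≤ T / 8 := by
      apply div_le_div_of_nonneg_left hT.le (by norm_num) (by nlinarith)
    simp only [hδ]
    linarith
  choose ρ _σ hρs _ _ hρ0 hρ1 hρ01 _ _ _ using fun k => exists_smooth_time_cutoff (hδ0 k)
  refine ⟨fun k t => ρ k t * ρ k (T - t), fun k => ?_, fun k => ?_, fun k => ?_, fun k t => ?_,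
    fun t ht => ?_⟩
  · exact (hρs k).mul ((hρs k).comp (contDiff_const.sub contDiff_id))
  · refine HasCompactSupport.intro (K := Icc (δ k) (T - δ k)) isCompact_Icc fun t ht => ?_
    rw [mem_Icc, not_and_or, not_le, not_le] at ht
    show ρ k t * ρ k (T - t) = 0
    rcases ht with ht | ht
    · rw [hρ0 k t ht.le, zero_mul]
    · rw [hρ0 k (T - t) (by linarith), mul_zero]
  · have hsupp : support (fun t => ρ k t * ρ k (T - t)) ⊆ Icc (δ k) (T - δ k) := by
      intro t ht
      rw [mem_support] at ht
      by_contra h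
      rw [mem_Icc, not_and_or, not_le, not_le] at h
      rcases h with h | h
      · exact ht (by rw [hρ0 k t h.le, zero_mul])
      · exact ht (by rw [hρ0 k (T - t) (by linarith), mul_zero])
    refine (closure_minimal hsupp isClosed_Icc).trans fun t ht => ?_
    exact ⟨lt_of_lt_of_le (hδ0 k) ht.1, lt_of_le_of_lt ht.2 (by linarith [hδ0 k])⟩
  · exact ⟨mul_nonneg (hρ01 k t).1 (hρ01 k (T - t)).1,
      mul_le_one₀ (hρ01 k t).2 (hρ01 k (T - t)).1 (hρ01 k (T - t)).2⟩
  · -- eventually `η_k t = 1`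
    have hδlim : Tendsto δ atTop (𝓝 0) := by
      have h1 : Tendsto (fun k : ℕ => T / 8 * (1 / ((k : ℝ) + 1))) atTop (𝓝 (T / 8 * 0)) :=
        tendsto_one_div_add_atTop_nhds_zero_nat.const_mul _
      rw [mul_zero] at h1
      refine h1.congr fun k => ?_
      simp only [hδ]
      field_simp
    have hev : ∀ᶠ k in atTop, 3 * δ k ≤ t ∧ 3 * δ k ≤ T - t := by
      have hm : 0 < min t (T - t) / 3 := by
        have := ht.1; have := ht.2
        positivity
      have := (tendsto_order.1 hδlim).2 _ hm
      filter_upwards [this] with k hk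
      constructor
      · have : min t (T - t) ≤ t := min_le_left _ _
        linarith
      · have : min t (T - t) ≤ T - t := min_le_right _ _
        linarith
    refine tendsto_const_nhds.congr' ?_
    filter_upwards [hev] with k hk
    rw [hρ1 k t hk.1, hρ1 k (T - t) hk.2, one_mul]

variable {E : Type*} [NormedAddCommGroup E] [InnerProductSpace ℝ E] [FiniteDimensional ℝ E]
  [MeasurableSpace E] [BorelSpace E]

/-- **Exhaustion of the slab by time cut-offs.** If `F` is integrable on `(0, T) × E` and
`∫∫ η(t) F(t, x) = 0` for every smooth compactly supported `η` with `tsupport η ⊆ (0, T)`, then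
`∫∫_{(0,T)×E} F = 0` (dominated convergence along the plateau cut-offs `η_k ↑ 1_{(0,T)}`). [folklore] -/
theorem setIntegral_slab_eq_zero_of_forall_time_cutoff {T : ℝ} (hT : 0 < T) {F : ℝ × E → ℝ}
    (hF : IntegrableOn F (Ioo 0 T ×ˢ (univ : Set E)) volume)
    (h : ∀ η : ℝ → ℝ, ContDiff ℝ (⊤ : ℕ∞) η → HasCompactSupport η → tsupport η ⊆ Ioo 0 T →
      ∫ z in Ioo 0 T ×ˢ (univ : Set E), η z.1 * F z = 0) :
    ∫ z in Ioo 0 T ×ˢ (univ : Set E), F z = 0 := by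
  obtain ⟨η, hηs, hηc, hηsupp, hη01, hηlim⟩ := exists_plateau_cutoffs hT
  set S : Set (ℝ × E) := Ioo 0 T ×ˢ (univ : Set E) with hS
  have hSm : MeasurableSet S := measurableSet_Ioo.prod MeasurableSet.univ
  have hηcont : ∀ k, Continuous fun z : ℝ × E => η k z.1 := fun k =>
    (hηs k).continuous.comp continuous_fst
  have hint : ∀ k, IntegrableOn (fun z : ℝ × E => η k z.1 * F z) S volume := fun k =>
    Integrable.bdd_mul (c := 1) hF (hηcont k).aestronglyMeasurable
      (ae_of_all _ fun z => by
        rw [Real.norm_eq_abs, abs_of_nonneg (hη01 k z.1).1]; exact (hη01 k z.1).2)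
  have hlim : Tendsto (fun k => ∫ z in S, η k z.1 * F z) atTop (𝓝 (∫ z in S, F z)) := by
    refine tendsto_integral_of_dominated_convergence (fun z => ‖F z‖)
      (fun k => (hint k).aestronglyMeasurable) hF.norm
      (fun k => ae_of_all _ fun z => ?_) ?_
    · rw [norm_mul, Real.norm_eq_abs, abs_of_nonneg (hη01 k z.1).1]
      exact mul_le_of_le_one_left (norm_nonneg _) (hη01 k z.1).2
    · rw [ae_restrict_iff' hSm]
      refine ae_of_all _ fun z hz => ?_
      have := (hηlim z.1 hz.1).mul_const (F z)
      rwa [one_mul] at this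
  have hzero : ∀ k, ∫ z in S, η k z.1 * F z = 0 := fun k => h (η k) (hηs k) (hηc k) (hηsupp k)
  simp only [hzero] at hlim
  exact (tendsto_nhds_unique tendsto_const_nhds hlim).symm

omit [FiniteDimensional ℝ E] [MeasurableSpace E] [BorelSpace E] in
/-- A smooth compactly supported `η` with `tsupport η ⊆ (0, T)` times a space–time test function
on the whole space–time is a test function on the open slab `(0, T) × E`. [folklore] -/
theorem isSpaceTimeTestOn_slab_time_mul {T : ℝ} {φ : ℝ → E → ℝ}
    (hφ : IsSpaceTimeTestOn (⊤ : Opens (ℝ × E)) φ) {η : ℝ → ℝ} (hηs : ContDiff ℝ (⊤ : ℕ∞) η)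
    (hηsupp : tsupport η ⊆ Ioo 0 T) :
    IsSpaceTimeTestOn (slab E (Ioo 0 T) isOpen_Ioo) (fun t x => η t * φ t x) := by
  refine (hφ.time_mul hηs).of_tsupport_subset ?_
  intro z hz
  have h1 : z ∈ tsupport fun z : ℝ × E => η z.1 := by
    have e : uncurry (fun t x => η t * φ t x) = (fun z : ℝ × E => η z.1) * uncurry φ := rfl
    rw [e] at hz
    exact tsupport_mul_subset_left hz
  have h2 : (tsupport fun z : ℝ × E => η z.1) ⊆ tsupport η ×ˢ (univ : Set E) := by
    refine closure_minimal (fun w hw => ⟨subset_tsupport _ hw, mem_univ _⟩) ?_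
    exact (isClosed_tsupport _).prod isClosed_univ
  exact mem_slab.2 (hηsupp (h2 h1).1)

end Cutoff

/-! ### Integrability toolkit: `L^p` on finite boxes, zero extensions -/

section Toolkit

variable {X : Type*} [MeasurableSpace X] {F : Type*} [NormedAddCommGroup F]

/-- On a set of finite measure, `∫ ‖f‖^p < ∞` with `p ≥ 1` gives integrability. [folklore] -/
theorem integrableOn_of_lintegral_rpow_lt_top {μ : Measure X} {s : Set X} {f : X → F}
    (hμs : μ s < ∞) (hf : AEStronglyMeasurable f (μ.restrict s)) {p : ℝ} (hp : 1 ≤ p)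
    (h : ∫⁻ x in s, ‖f x‖ₑ ^ p ∂μ < ∞) : IntegrableOn f s μ := by
  haveI : IsFiniteMeasure (μ.restrict s) := ⟨by rw [Measure.restrict_apply_univ]; exact hμs⟩
  have hp0 : 0 < p := lt_of_lt_of_le one_pos hp
  have hM : MemLp f (ENNReal.ofReal p) (μ.restrict s) := by
    refine ⟨hf, ?_⟩
    rw [eLpNorm_lt_top_iff_lintegral_rpow_enorm_lt_top (ENNReal.ofReal_pos.2 hp0).ne'
      ENNReal.ofReal_ne_top, ENNReal.toReal_ofReal hp0.le]
    exact h
  exact (hM.mono_exponent (p := 1) (by rw [← ENNReal.ofReal_one]; exact ENNReal.ofReal_le_ofReal hp)).integrable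
    le_rfl

end Toolkit

section Extension

variable {T : ℝ}

/-- The zero extension outside `(0, T)` in time, uncurried, is the indicator of the slab. [folklore] -/
theorem uncurry_eq_indicator_slab {F : Type*} [Zero F] {v U : ℝ → EuclideanSpace ℝ (Fin 3) → F}
    (hUin : ∀ t ∈ Ioo 0 T, U t = v t) (hUout : ∀ t, t ∉ Ioo 0 T → U t = 0) :
    uncurry U = (Ioo 0 T ×ˢ (univ : Set (EuclideanSpace ℝ (Fin 3)))).indicator (uncurry v) := by
  funext z
  by_cases hz : z.1 ∈ Ioo 0 T
  · rw [indicator_of_mem (show z ∈ Ioo 0 T ×ˢ (univ : Set (EuclideanSpace ℝ (Fin 3))) from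
      ⟨hz, mem_univ _⟩)]
    simp only [uncurry, hUin z.1 hz]
  · rw [indicator_of_notMem (show z ∉ Ioo 0 T ×ˢ (univ : Set (EuclideanSpace ℝ (Fin 3))) from
      fun h => hz h.1)]
    simp only [uncurry, hUout z.1 hz, Pi.zero_apply]

/-- **The zero extension of a function integrable on the slab boxes `(0,T) × K` is locally
integrable on space–time.** [folklore] -/
theorem locallyIntegrable_indicator_slab {F : Type*} [NormedAddCommGroup F]
    {g : ℝ × EuclideanSpace ℝ (Fin 3) → F}
    (hg : ∀ K : Set (EuclideanSpace ℝ (Fin 3)), IsCompact K → IntegrableOn g (Ioo 0 T ×ˢ K) volume) :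
    LocallyIntegrable ((Ioo 0 T ×ˢ (univ : Set (EuclideanSpace ℝ (Fin 3)))).indicator g) volume := by
  set S : Set (ℝ × EuclideanSpace ℝ (Fin 3)) := Ioo 0 T ×ˢ (univ : Set (EuclideanSpace ℝ (Fin 3))) with hS
  have hSm : MeasurableSet S := measurableSet_Ioo.prod MeasurableSet.univ
  refine (locallyIntegrable_iff).2 fun C hC => ?_
  set K : Set (EuclideanSpace ℝ (Fin 3)) := Prod.snd '' C with hK
  have hKc : IsCompact K := hC.image continuous_snd
  have hsub : S ∩ C ⊆ Ioo 0 T ×ˢ K := fun z hz => ⟨hz.1.1, ⟨z, hz.2, rfl⟩⟩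
  have h1 : IntegrableOn g (S ∩ C) volume := (hg K hKc).mono_set hsub
  show Integrable (S.indicator g) (volume.restrict C)
  rw [integrable_indicator_iff hSm]
  show Integrable g ((volume.restrict C).restrict S)
  rw [Measure.restrict_restrict hSm]
  exact h1

/-- The local integrability of the zero extension on any open space–time region. [folklore] -/
theorem locallyIntegrableOn_indicator_slab {F : Type*} [NormedAddCommGroup F]
    {g : ℝ × EuclideanSpace ℝ (Fin 3) → F}
    (hg : ∀ K : Set (EuclideanSpace ℝ (Fin 3)), IsCompact K → IntegrableOn g (Ioo 0 T ×ˢ K) volume)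
    (Ω : Set (ℝ × EuclideanSpace ℝ (Fin 3))) :
    LocallyIntegrableOn ((Ioo 0 T ×ˢ (univ : Set (EuclideanSpace ℝ (Fin 3)))).indicator g) Ω volume :=
  (locallyIntegrable_indicator_slab hg).locallyIntegrableOn Ω

/-- Iterated integrals of a slab indicator: `∫ t, ∫ x, 1_S f (t,x) = ∫∫_S f` when `1_S f` is
integrable on space–time. [folklore] -/
theorem integral_integral_indicator_slab {f : ℝ × EuclideanSpace ℝ (Fin 3) → ℝ}
    (hf : Integrable ((Ioo 0 T ×ˢ (univ : Set (EuclideanSpace ℝ (Fin 3)))).indicator f) volume) :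
    ∫ t, ∫ x, (Ioo 0 T ×ˢ (univ : Set (EuclideanSpace ℝ (Fin 3)))).indicator f (t, x) =
      ∫ z in Ioo 0 T ×ˢ (univ : Set (EuclideanSpace ℝ (Fin 3))), f z := by
  rw [← integral_indicator (measurableSet_Ioo.prod MeasurableSet.univ), Measure.volume_eq_prod,
    integral_prod _ (by rw [← Measure.volume_eq_prod]; exact hf)]

end Extension

/-! ### The classes of a local energy solution on the slab boxes up to `t = 0` -/

section Classes

variable {T ν : ℝ} {v₀ : EuclideanSpace ℝ (Fin 3) → EuclideanSpace ℝ (Fin 3)}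
  {v : ℝ → EuclideanSpace ℝ (Fin 3) → EuclideanSpace ℝ (Fin 3)}
  {π : ℝ → EuclideanSpace ℝ (Fin 3) → ℝ}
  {G : ℝ → EuclideanSpace ℝ (Fin 3) → EuclideanSpace ℝ (Fin 3) →L[ℝ] EuclideanSpace ℝ (Fin 3)}

/-- A weak gradient with finite `L²` norms on the boxes `(0,T) × B_R` is, together with `|G|²`,
integrable on the slab boxes `(0,T) × K` up to `t = 0`. [folklore] -/
theorem integrableOn_grad_box
    (hG : HasWeakSpatialGradientOn (slab (EuclideanSpace ℝ (Fin 3)) (Ioo 0 T) isOpen_Ioo) v G)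
    (hGb : ∀ R : ℝ, 0 < R → ∃ C : ℝ≥0, ∀ x₀ : EuclideanSpace ℝ (Fin 3),
      ∫⁻ z in Ioo 0 T ×ˢ ball x₀ R, ENNReal.ofReal (frobeniusNormSq (G z.1 z.2)) ≤ C)
    {K : Set (EuclideanSpace ℝ (Fin 3))} (hK : IsCompact K) :
    IntegrableOn (uncurry G) (Ioo 0 T ×ˢ K) volume ∧
      IntegrableOn (fun z : ℝ × EuclideanSpace ℝ (Fin 3) => frobeniusNormSq (G z.1 z.2)) (Ioo 0 T ×ˢ K) volume := by
  obtain ⟨r, hr⟩ := hK.isBounded.subset_ball (0 : EuclideanSpace ℝ (Fin 3))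
  set R : ℝ := max r 1 with hR
  have hRpos : 0 < R := lt_of_lt_of_le one_pos (le_max_right _ _)
  have hKR : K ⊆ ball (0 : EuclideanSpace ℝ (Fin 3)) R := hr.trans (ball_subset_ball (le_max_left _ _))
  obtain ⟨C, hC⟩ := hGb R hRpos
  have hfin : ∫⁻ z in Ioo 0 T ×ˢ K, ENNReal.ofReal (frobeniusNormSq (G z.1 z.2)) < ∞ :=
    lt_of_le_of_lt (lintegral_mono_set (prod_mono Subset.rfl hKR)) ((hC 0).trans_lt ENNReal.coe_lt_top)
  have hslab : ((slab (EuclideanSpace ℝ (Fin 3)) (Ioo 0 T) isOpen_Ioo :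
      Opens (ℝ × EuclideanSpace ℝ (Fin 3))) : Set (ℝ × EuclideanSpace ℝ (Fin 3))) =
      Ioo (0 : ℝ) T ×ˢ univ := rfl
  have hGm : AEStronglyMeasurable (uncurry G) (volume.restrict (Ioo (0 : ℝ) T ×ˢ K)) := by
    have h1 : AEStronglyMeasurable (uncurry G) (volume.restrict (Ioo (0 : ℝ) T ×ˢ univ)) := by
      rw [← hslab]; exact hG.locallyIntegrableOn_grad.aestronglyMeasurable
    exact h1.mono_measure (Measure.restrict_mono (Set.prod_mono Subset.rfl (subset_univ _)) le_rfl)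
  have hFm : AEStronglyMeasurable (fun z : ℝ × EuclideanSpace ℝ (Fin 3) => frobeniusNormSq (G z.1 z.2))
      (volume.restrict (Ioo (0 : ℝ) T ×ˢ K)) :=
    continuous_frobeniusNormSq'.comp_aestronglyMeasurable hGm
  refine ⟨?_, ⟨hFm, ?_⟩⟩
  · refine integrableOn_of_lintegral_rpow_lt_top (volume_Ioo_prod_lt_top hK) hGm (p := 2) (by norm_num) ?_
    refine lt_of_le_of_lt (lintegral_mono fun z => ?_) hfin
    rw [show (2 : ℝ) = ((2 : ℕ) : ℝ) by norm_num, ENNReal.rpow_natCast]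
    exact enorm_opNorm_sq_le_ofReal_frobeniusNormSq _
  · rw [hasFiniteIntegral_iff_enorm]
    refine lt_of_le_of_lt (lintegral_mono fun z => le_of_eq ?_) hfin
    rw [Real.enorm_eq_ofReal (frobeniusNormSq_nonneg _)]

end Classes

/-! ### The weak gradient, the divergence and the pressure equation of the zero extension -/

section Identities

variable {T ν : ℝ} {v₀ : EuclideanSpace ℝ (Fin 3) → EuclideanSpace ℝ (Fin 3)}
  {v U : ℝ → EuclideanSpace ℝ (Fin 3) → EuclideanSpace ℝ (Fin 3)}
  {π P : ℝ → EuclideanSpace ℝ (Fin 3) → ℝ}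
  {G Gt : ℝ → EuclideanSpace ℝ (Fin 3) → EuclideanSpace ℝ (Fin 3) →L[ℝ] EuclideanSpace ℝ (Fin 3)}

/-- An iterated integral of a function agreeing with `η(t) f(t, x)` for `t ∈ (0, T)` and vanishing
elsewhere (because `tsupport η ⊆ (0, T)`) is the integral of `η f` over the slab. [folklore] -/
theorem integral_integral_time_cutoff_eq_setIntegral {f : ℝ × EuclideanSpace ℝ (Fin 3) → ℝ}
    {Φ : ℝ → EuclideanSpace ℝ (Fin 3) → ℝ} {η : ℝ → ℝ} (hηsupp : tsupport η ⊆ Ioo 0 T)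
    (hΦ : ∀ t ∈ Ioo 0 T, ∀ x, Φ t x = η t * f (t, x)) (hΦ0 : ∀ t, t ∉ Ioo 0 T → ∀ x, Φ t x = η t * f (t, x) ∨ Φ t x = 0)
    (hI : Integrable (uncurry Φ) volume) :
    ∫ t, ∫ x, Φ t x = ∫ z in Ioo 0 T ×ˢ (univ : Set (EuclideanSpace ℝ (Fin 3))), η z.1 * f z := by
  have hη0 : ∀ t, t ∉ Ioo 0 T → η t = 0 := fun t ht =>
    image_eq_zero_of_notMem_tsupport fun h' => ht (hηsupp h')
  have e : uncurry Φ = (Ioo 0 T ×ˢ (univ : Set (EuclideanSpace ℝ (Fin 3)))).indicator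
      fun z => η z.1 * f z := by
    funext z
    by_cases hz : z.1 ∈ Ioo 0 T
    · rw [indicator_of_mem (show z ∈ Ioo 0 T ×ˢ (univ : Set (EuclideanSpace ℝ (Fin 3))) from
        ⟨hz, mem_univ _⟩)]
      exact hΦ z.1 hz z.2
    · rw [indicator_of_notMem (show z ∉ Ioo 0 T ×ˢ (univ : Set (EuclideanSpace ℝ (Fin 3))) from
        fun h' => hz h'.1)]
      rcases hΦ0 z.1 hz z.2 with h' | h'
      · rw [uncurry, h', hη0 z.1 hz, zero_mul]
      · exact h'
  have hI' : Integrable ((Ioo 0 T ×ˢ (univ : Set (EuclideanSpace ℝ (Fin 3)))).indicator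
      fun z => η z.1 * f z) volume := by rw [← e]; exact hI
  rw [← integral_integral_indicator_slab hI']
  refine integral_congr_ae (Eventually.of_forall fun t => integral_congr_ae
    (Eventually.of_forall fun x => ?_))
  exact congrFun e (t, x)

/-- **The zero extension has the zero-extended weak gradient on all of space–time.** For a local
energy solution `(v, π)` on `ℝ³ × (0, T)` with a weak spatial gradient `G` on the slab whose `L²`
norms on the boxes `(0,T) × B_R` are finite, the extensions `U`, `G̃` of `v`, `G` by zero outside
`(0, T)` satisfy `∫∫ ∂_a φ ⟪U, w⟫ = -∫∫ φ ⟪G̃ a, w⟫` for every space–time test `φ` (the identity on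
the slab for the tests `η_k(t) φ`, `η_k ↑ 1_{(0,T)}`, passes to the limit: no time derivative is
involved). [folklore] -/
theorem hasWeakSpatialGradientOn_extension (h : IsLocalEnergySolutionOn T ν v₀ v π) (hT : 0 < T)
    (hG : HasWeakSpatialGradientOn (slab (EuclideanSpace ℝ (Fin 3)) (Ioo 0 T) isOpen_Ioo) v G)
    (hGb : ∀ R : ℝ, 0 < R → ∃ C : ℝ≥0, ∀ x₀ : EuclideanSpace ℝ (Fin 3),
      ∫⁻ z in Ioo 0 T ×ˢ ball x₀ R, ENNReal.ofReal (frobeniusNormSq (G z.1 z.2)) ≤ C)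
    (hUin : ∀ t ∈ Ioo 0 T, U t = v t) (hUout : ∀ t, t ∉ Ioo 0 T → U t = 0)
    (hGin : ∀ t ∈ Ioo 0 T, Gt t = G t) (hGout : ∀ t, t ∉ Ioo 0 T → Gt t = 0) :
    HasWeakSpatialGradientOn (⊤ : Opens (ℝ × EuclideanSpace ℝ (Fin 3))) U Gt := by
  set S : Set (ℝ × EuclideanSpace ℝ (Fin 3)) := Ioo 0 T ×ˢ (univ : Set (EuclideanSpace ℝ (Fin 3))) with hS
  have hSm : MeasurableSet S := measurableSet_Ioo.prod MeasurableSet.univ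
  have hUli : LocallyIntegrable (uncurry U) volume := by
    rw [uncurry_eq_indicator_slab hUin hUout]
    exact locallyIntegrable_indicator_slab fun K hK => (h.integrableOn_velocity hK).1
  have hGli : LocallyIntegrable (uncurry Gt) volume := by
    rw [uncurry_eq_indicator_slab hGin hGout]
    exact locallyIntegrable_indicator_slab fun K hK => (integrableOn_grad_box hG hGb hK).1
  refine ⟨hUli.locallyIntegrableOn _, hGli.locallyIntegrableOn _, fun φ hφ a w => ?_⟩
  -- the two integrands on the slab
  set f₁ : ℝ × EuclideanSpace ℝ (Fin 3) → ℝ := fun z => fderiv ℝ (φ z.1) z.2 a * ⟪v z.1 z.2, w⟫ with hf₁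
  set f₂ : ℝ × EuclideanSpace ℝ (Fin 3) → ℝ := fun z => φ z.1 z.2 * ⟪G z.1 z.2 a, w⟫ with hf₂
  -- their extensions, written with `U`, `Gt`
  set g₁ : ℝ × EuclideanSpace ℝ (Fin 3) → ℝ := fun z => fderiv ℝ (φ z.1) z.2 a * ⟪U z.1 z.2, w⟫ with hg₁
  set g₂ : ℝ × EuclideanSpace ℝ (Fin 3) → ℝ := fun z => φ z.1 z.2 * ⟪Gt z.1 z.2 a, w⟫ with hg₂
  have hg₁S : ∀ z ∈ S, g₁ z = f₁ z := fun z hz => by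
    simp only [hg₁, hf₁, hUin z.1 hz.1]
  have hg₂S : ∀ z ∈ S, g₂ z = f₂ z := fun z hz => by
    simp only [hg₂, hf₂, hGin z.1 hz.1]
  have hg₁0 : ∀ z, z ∉ S → g₁ z = 0 := fun z hz => by
    have : z.1 ∉ Ioo 0 T := fun h' => hz ⟨h', mem_univ _⟩
    simp only [hg₁, hUout z.1 this, Pi.zero_apply, inner_zero_left, mul_zero]
  have hg₂0 : ∀ z, z ∉ S → g₂ z = 0 := fun z hz => by
    have : z.1 ∉ Ioo 0 T := fun h' => hz ⟨h', mem_univ _⟩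
    simp only [hg₂, hGout z.1 this, Pi.zero_apply, zero_apply, inner_zero_left,
      mul_zero]
  have hg₁ind : g₁ = S.indicator f₁ := by
    funext z
    by_cases hz : z ∈ S
    · rw [indicator_of_mem hz, hg₁S z hz]
    · rw [indicator_of_notMem hz, hg₁0 z hz]
  have hg₂ind : g₂ = S.indicator f₂ := by
    funext z
    by_cases hz : z ∈ S
    · rw [indicator_of_mem hz, hg₂S z hz]
    · rw [indicator_of_notMem hz, hg₂0 z hz]
  -- integrability of the extensions
  set K := tsupport (uncurry φ) with hK
  have hKc : IsCompact K := hφ.hasCompactSupport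
  have hcφ : Continuous fun z : ℝ × EuclideanSpace ℝ (Fin 3) => φ z.1 z.2 := hφ.contDiff.continuous
  have hcD : Continuous fun z : ℝ × EuclideanSpace ℝ (Fin 3) => fderiv ℝ (φ z.1) z.2 a :=
    (hφ.fderiv_apply_top a).contDiff.continuous
  have hφK : ∀ z ∉ K, φ z.1 z.2 = 0 := fun z hz =>
    show uncurry φ z = 0 from image_eq_zero_of_notMem_tsupport hz
  have hDK : ∀ z ∉ K, fderiv ℝ (φ z.1) z.2 a = 0 := fun z hz => by
    rw [IsSpaceTimeTestOn.fderiv_slice_eq_zero_of_notMem hz, zero_apply]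
  have hIg₁ : Integrable g₁ volume := by
    have h1 : Integrable (fun z : ℝ × EuclideanSpace ℝ (Fin 3) =>
        ⟪U z.1 z.2, (fderiv ℝ (φ z.1) z.2 a) • w⟫) volume :=
      integrable_inner_of_locallyIntegrableOn (Q := ⊤) (hUli.locallyIntegrableOn _)
        (hcD.smul continuous_const) hKc (fun _ _ => trivial) fun z hz => by rw [hDK z hz, zero_smul]
    refine h1.congr (Eventually.of_forall fun z => ?_)
    simp only [hg₁, real_inner_smul_right]
  have hIg₂ : Integrable g₂ volume := by
    -- `|g₂| ≤ C ‖Gt‖ ‖a‖ ‖w‖` on `K`, zero off `K`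
    obtain ⟨Cφ, hCφ⟩ := hcφ.bounded_above_of_compact_support (HasCompactSupport.intro hKc hφK)
    have hGK : IntegrableOn (uncurry Gt) K volume := hGli.integrableOn_isCompact hKc
    have hm : AEStronglyMeasurable g₂ volume := by
      have hGm : AEStronglyMeasurable (uncurry Gt) volume := hGli.aestronglyMeasurable
      have h1 : AEStronglyMeasurable (fun z : ℝ × EuclideanSpace ℝ (Fin 3) => (uncurry Gt z) a) volume :=
        (ContinuousLinearMap.apply ℝ (EuclideanSpace ℝ (Fin 3)) a).continuous.comp_aestronglyMeasurable hGm
      exact hcφ.aestronglyMeasurable.mul (h1.inner aestronglyMeasurable_const)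
    have hsupp : support g₂ ⊆ K := by
      intro z hz
      by_contra hzK
      exact hz (by simp only [hg₂, hφK z hzK, zero_mul])
    refine (integrableOn_iff_integrable_of_support_subset hsupp).1 ?_
    refine Integrable.mono' ((hGK.norm.const_mul (Cφ * (‖a‖ * ‖w‖)))) hm.restrict
      (ae_of_all _ fun z => ?_)
    simp only [hg₂, norm_mul, Real.norm_eq_abs]
    have hC0 : 0 ≤ Cφ := (norm_nonneg _).trans (hCφ z)
    calc |φ z.1 z.2| * |⟪Gt z.1 z.2 a, w⟫|
        ≤ Cφ * (‖Gt z.1 z.2 a‖ * ‖w‖) :=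
          mul_le_mul ((Real.norm_eq_abs _).symm.le.trans (hCφ z)) (abs_real_inner_le_norm _ _)
            (abs_nonneg _) hC0
      _ ≤ Cφ * (‖Gt z.1 z.2‖ * ‖a‖ * ‖w‖) := by
          have hC0 : 0 ≤ Cφ := (norm_nonneg _).trans (hCφ z)
          gcongr
          exact ContinuousLinearMap.le_opNorm _ _
      _ = Cφ * (‖a‖ * ‖w‖) * ‖uncurry Gt z‖ := by simp only [uncurry]; ring
  have hIf₁ : IntegrableOn f₁ S volume := by
    have : IntegrableOn g₁ S volume := hIg₁.integrableOn
    exact this.congr_fun hg₁S hSm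
  have hIf₂ : IntegrableOn f₂ S volume := by
    have : IntegrableOn g₂ S volume := hIg₂.integrableOn
    exact this.congr_fun hg₂S hSm
  -- the identity on the slab, by exhaustion
  have hzero : ∫ z in S, (f₁ z + f₂ z) = 0 := by
    refine setIntegral_slab_eq_zero_of_forall_time_cutoff hT (hIf₁.add hIf₂) fun η hηs hηc hηsupp => ?_
    have hψ := isSpaceTimeTestOn_slab_time_mul hφ hηs hηsupp
    have key := hG.integral_fderiv_mul_inner_eq _ hψ a w
    have hηb : ∃ Cη, ∀ t, ‖η t‖ ≤ Cη := by
      obtain ⟨Cη, hCη⟩ := hηs.continuous.bounded_above_of_compact_support hηc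
      exact ⟨Cη, hCη⟩
    obtain ⟨Cη, hCη⟩ := hηb
    have hηcont : Continuous fun z : ℝ × EuclideanSpace ℝ (Fin 3) => η z.1 := hηs.continuous.comp continuous_fst
    have hη0 : ∀ t, t ∉ Ioo 0 T → η t = 0 := fun t ht =>
      image_eq_zero_of_notMem_tsupport fun h' => ht (hηsupp h')
    -- derivative of the product slice
    have hfd : ∀ t x, fderiv ℝ (fun x => η t * φ t x) x a = η t * fderiv ℝ (φ t) x a := by
      intro t x
      have hd : DifferentiableAt ℝ (φ t) x :=
        ((hφ.contDiff_slice t).differentiable (by simp)).differentiableAt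
      rw [fderiv_const_mul hd, FunLike.coe_smul, Pi.smul_apply, smul_eq_mul]
    -- left-hand side as a slab integral
    have hL : ∫ t, ∫ x, fderiv ℝ (fun x => η t * φ t x) x a * ⟪v t x, w⟫ = ∫ z in S, η z.1 * f₁ z := by
      refine integral_integral_time_cutoff_eq_setIntegral (f := f₁)
        (Φ := fun t x => fderiv ℝ (fun x => η t * φ t x) x a * ⟪v t x, w⟫) hηsupp
        (fun t _ x => by rw [hfd]; simp only [hf₁]; ring)
        (fun t _ x => Or.inl (by rw [hfd]; simp only [hf₁]; ring)) ?_
      have e : uncurry (fun t x => fderiv ℝ (fun x => η t * φ t x) x a * ⟪v t x, w⟫) =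
          fun z => η z.1 * g₁ z := by
        funext z
        simp only [uncurry, hfd, hg₁]
        by_cases hz : z.1 ∈ Ioo 0 T
        · rw [hUin z.1 hz]; ring
        · rw [hη0 z.1 hz]; ring
      rw [e]
      exact hIg₁.bdd_mul hηcont.aestronglyMeasurable (ae_of_all _ fun z => hCη z.1)
    have hR : ∫ t, ∫ x, (η t * φ t x) * ⟪G t x a, w⟫ = ∫ z in S, η z.1 * f₂ z := by
      refine integral_integral_time_cutoff_eq_setIntegral (f := f₂)
        (Φ := fun t x => (η t * φ t x) * ⟪G t x a, w⟫) hηsupp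
        (fun t _ x => by simp only [hf₂]; ring) (fun t _ x => Or.inl (by simp only [hf₂]; ring)) ?_
      have e : uncurry (fun t x => (η t * φ t x) * ⟪G t x a, w⟫) = fun z => η z.1 * g₂ z := by
        funext z
        simp only [uncurry, hg₂]
        by_cases hz : z.1 ∈ Ioo 0 T
        · rw [hGin z.1 hz]; ring
        · rw [hη0 z.1 hz]; ring
      rw [e]
      exact hIg₂.bdd_mul hηcont.aestronglyMeasurable (ae_of_all _ fun z => hCη z.1)
    rw [hL, hR] at key
    have hI1 : IntegrableOn (fun z => η z.1 * f₁ z) S volume :=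
      hIf₁.bdd_mul hηcont.aestronglyMeasurable (ae_of_all _ fun z => hCη z.1)
    have hI2 : IntegrableOn (fun z => η z.1 * f₂ z) S volume :=
      hIf₂.bdd_mul hηcont.aestronglyMeasurable (ae_of_all _ fun z => hCη z.1)
    calc ∫ z in S, η z.1 * (f₁ z + f₂ z) = ∫ z in S, (η z.1 * f₁ z + η z.1 * f₂ z) :=
          integral_congr_ae (Eventually.of_forall fun z => by ring)
      _ = (∫ z in S, η z.1 * f₁ z) + ∫ z in S, η z.1 * f₂ z := integral_add hI1 hI2
      _ = 0 := by rw [key]; ring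
  -- conclusion
  have hL : ∫ t, ∫ x, fderiv ℝ (φ t) x a * ⟪U t x, w⟫ = ∫ z in S, f₁ z := by
    have e : uncurry (fun t x => fderiv ℝ (φ t) x a * ⟪U t x, w⟫) = g₁ := rfl
    rw [show (fun t => ∫ x, fderiv ℝ (φ t) x a * ⟪U t x, w⟫) = fun t => ∫ x, S.indicator f₁ (t, x) by
      funext t; refine integral_congr_ae (Eventually.of_forall fun x => ?_); exact congrFun hg₁ind (t, x)]
    exact integral_integral_indicator_slab (by rw [← hg₁ind]; exact hIg₁)
  have hR : ∫ t, ∫ x, φ t x * ⟪Gt t x a, w⟫ = ∫ z in S, f₂ z := by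
    rw [show (fun t => ∫ x, φ t x * ⟪Gt t x a, w⟫) = fun t => ∫ x, S.indicator f₂ (t, x) by
      funext t; refine integral_congr_ae (Eventually.of_forall fun x => ?_); exact congrFun hg₂ind (t, x)]
    exact integral_integral_indicator_slab (by rw [← hg₂ind]; exact hIg₂)
  rw [hL, hR]
  rw [integral_add hIf₁ hIf₂] at hzero
  linarith

/-- **The zero extension is divergence free against every space–time test**:
`∫∫ ⟪U, ∇θ⟫ = 0` (the identity `div v = 0` on the slab for the tests `η_k(t) θ`, passed to the
limit `η_k ↑ 1_{(0,T)}`). [folklore] -/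
theorem integral_inner_gradient_extension_eq_zero (h : IsLocalEnergySolutionOn T ν v₀ v π) (hT : 0 < T)
    (hUin : ∀ t ∈ Ioo 0 T, U t = v t) (hUout : ∀ t, t ∉ Ioo 0 T → U t = 0)
    {θ : ℝ → EuclideanSpace ℝ (Fin 3) → ℝ} (hθ : IsSpaceTimeTestOn (⊤ : Opens (ℝ × EuclideanSpace ℝ (Fin 3))) θ) :
    ∫ z : ℝ × EuclideanSpace ℝ (Fin 3), ⟪U z.1 z.2, gradient (θ z.1) z.2⟫ = 0 := by
  set S : Set (ℝ × EuclideanSpace ℝ (Fin 3)) := Ioo 0 T ×ˢ (univ : Set (EuclideanSpace ℝ (Fin 3))) with hS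
  have hSm : MeasurableSet S := measurableSet_Ioo.prod MeasurableSet.univ
  have hUli : LocallyIntegrable (uncurry U) volume := by
    rw [uncurry_eq_indicator_slab hUin hUout]
    exact locallyIntegrable_indicator_slab fun K hK => (h.integrableOn_velocity hK).1
  obtain ⟨hcg, -, hg0⟩ := hθ.continuous_gradient_field
  have hKc : IsCompact (tsupport (uncurry θ)) := hθ.hasCompactSupport
  set f : ℝ × EuclideanSpace ℝ (Fin 3) → ℝ := fun z => ⟪v z.1 z.2, gradient (θ z.1) z.2⟫ with hf
  set g : ℝ × EuclideanSpace ℝ (Fin 3) → ℝ := fun z => ⟪U z.1 z.2, gradient (θ z.1) z.2⟫ with hg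
  have hgind : g = S.indicator f := by
    funext z
    by_cases hz : z ∈ S
    · rw [indicator_of_mem hz]; simp only [hg, hf, hUin z.1 hz.1]
    · rw [indicator_of_notMem hz]
      have : z.1 ∉ Ioo 0 T := fun h' => hz ⟨h', mem_univ _⟩
      simp only [hg, hUout z.1 this, Pi.zero_apply, inner_zero_left]
  have hIg : Integrable g volume :=
    integrable_inner_of_locallyIntegrableOn (Q := ⊤) (hUli.locallyIntegrableOn _) hcg hKc
      (fun _ _ => trivial) hg0
  have hIf : IntegrableOn f S volume :=
    (hIg.integrableOn : IntegrableOn g S volume).congr_fun (fun z hz => by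
      rw [hgind, indicator_of_mem hz]) hSm
  have hdiv := h.distributional.2.2.2.1
  have hzero : ∫ z in S, f z = 0 := by
    refine setIntegral_slab_eq_zero_of_forall_time_cutoff hT hIf fun η hηs _ hηsupp => ?_
    have hψ := isSpaceTimeTestOn_slab_time_mul hθ hηs hηsupp
    have key := hdiv _ hψ
    have hgr : ∀ t x, gradient (fun x => η t * θ t x) x = η t • gradient (θ t) x := by
      intro t x
      have hd : DifferentiableAt ℝ (θ t) x :=
        ((hθ.contDiff_slice t).differentiable (by simp)).differentiableAt
      rw [gradient, gradient, fderiv_const_mul hd, map_smul]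
    refine Eq.trans (setIntegral_congr_fun hSm fun z _ => ?_) key
    show η z.1 * f z = ⟪v z.1 z.2, gradient ((fun t x => η t * θ t x) z.1) z.2⟫
    rw [hgr, real_inner_smul_right]
  calc ∫ z, g z = ∫ z, S.indicator f z := by rw [hgind]
    _ = ∫ z in S, f z := integral_indicator hSm
    _ = 0 := hzero

/-- **The pressure equation of the zero extension against every space–time test**:
`∫∫ (⟪U, (U·∇)∇φ⟫ + P Δφ) = 0`, i.e. `-ΔP = ∂ᵢ∂ⱼ(UᵢUⱼ)` in `𝒟'(ℝ × ℝ³)` (the weak pressure Poisson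
equation of the slab, `IsDistributionalNSSolutionOn.integral_hessian_add_pressure_laplacian_eq_zero_of_iterated`,
for the tests `η_k(t) φ`, passed to the limit). [cite: LemarieRieusset2016, (13.19)] -/
theorem pressureEq_extension (h : IsLocalEnergySolutionOn T ν v₀ v π) (hT : 0 < T)
    (hUin : ∀ t ∈ Ioo 0 T, U t = v t) (hUout : ∀ t, t ∉ Ioo 0 T → U t = 0)
    (hPin : ∀ t ∈ Ioo 0 T, P t = π t) (hPout : ∀ t, t ∉ Ioo 0 T → P t = 0)
    {φ : ℝ → EuclideanSpace ℝ (Fin 3) → ℝ} (hφ : IsSpaceTimeTestOn (⊤ : Opens (ℝ × EuclideanSpace ℝ (Fin 3))) φ) :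
    ∫ z : ℝ × EuclideanSpace ℝ (Fin 3),
      (⟪U z.1 z.2, convect (U z.1) (gradient (φ z.1)) z.2⟫ + P z.1 z.2 * Δ (φ z.1) z.2) = 0 := by
  set S : Set (ℝ × EuclideanSpace ℝ (Fin 3)) := Ioo 0 T ×ˢ (univ : Set (EuclideanSpace ℝ (Fin 3))) with hS
  have hSm : MeasurableSet S := measurableSet_Ioo.prod MeasurableSet.univ
  -- the extensions: local integrability
  have hUind := uncurry_eq_indicator_slab hUin hUout
  have hPind := uncurry_eq_indicator_slab hPin hPout
  have hUli : LocallyIntegrable (uncurry U) volume := by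
    rw [hUind]; exact locallyIntegrable_indicator_slab fun K hK => (h.integrableOn_velocity hK).1
  have hPli : LocallyIntegrable (uncurry P) volume := by
    rw [hPind]; exact locallyIntegrable_indicator_slab fun K hK => h.integrableOn_pressure hK
  have hU2li : LocallyIntegrable (fun z : ℝ × EuclideanSpace ℝ (Fin 3) => ‖uncurry U z‖ ^ 2) volume := by
    have e : (fun z : ℝ × EuclideanSpace ℝ (Fin 3) => ‖uncurry U z‖ ^ 2) =
        S.indicator fun z => ‖uncurry v z‖ ^ 2 := by
      funext z
      rw [hUind]
      by_cases hz : z ∈ S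
      · rw [indicator_of_mem hz, indicator_of_mem hz]
      · rw [indicator_of_notMem hz, indicator_of_notMem hz, norm_zero]; ring
    rw [e]
    exact locallyIntegrable_indicator_slab fun K hK => (h.integrableOn_velocity hK).2
  -- the test function: support, bounds, continuity of the derivatives
  set K := tsupport (uncurry φ) with hK
  have hKc : IsCompact K := hφ.hasCompactSupport
  have hφ2 : ∀ t, ContDiff ℝ 2 (φ t) := fun t => contDiff_infty.1 (hφ.contDiff_slice t) 2
  obtain ⟨hcg, -, hg0⟩ := hφ.continuous_gradient_field
  have hgradK : tsupport (uncurry fun t x => gradient (φ t) x) ⊆ K :=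
    closure_minimal (fun z hz => by
      by_contra hzK
      exact hz (hg0 z hzK)) (isClosed_tsupport _)
  set H : ℝ × EuclideanSpace ℝ (Fin 3) → EuclideanSpace ℝ (Fin 3) →L[ℝ] EuclideanSpace ℝ (Fin 3) :=
    fun z => fderiv ℝ (fun x => gradient (φ z.1) x) z.2 with hH
  have hgt : IsSpaceTimeTestOn (⊤ : Opens (ℝ × EuclideanSpace ℝ (Fin 3))) (fun t x => gradient (φ t) x) :=
    hφ.gradient_isSpaceTimeTestOn
  have hcH : Continuous H := by
    have := (IsSpaceTimeTestOn.fderiv_top hgt).contDiff.continuous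
    exact this
  have hH0 : ∀ z ∉ K, H z = 0 := fun z hz =>
    IsSpaceTimeTestOn.fderiv_slice_eq_zero_of_notMem (ψ := fun t x => gradient (φ t) x)
      fun h' => hz (hgradK h')
  have hcL : Continuous fun z : ℝ × EuclideanSpace ℝ (Fin 3) => Δ (φ z.1) z.2 :=
    hφ.laplacian_top.contDiff.continuous
  have hLK : ∀ z ∉ K, Δ (φ z.1) z.2 = 0 := fun z hz =>
    laplacian_eq_zero_of_notMem_tsupport (notMem_tsupport_slice hz)
  obtain ⟨CH, hCH⟩ := hcH.bounded_above_of_compact_support (HasCompactSupport.intro hKc hH0)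
  have hCH0 : 0 ≤ CH := (norm_nonneg _).trans (hCH (0, 0))
  have hconv : ∀ (u : ℝ → EuclideanSpace ℝ (Fin 3) → EuclideanSpace ℝ (Fin 3)) (z : ℝ × EuclideanSpace ℝ (Fin 3)),
      convect (u z.1) (gradient (φ z.1)) z.2 = H z (u z.1 z.2) := fun u z => rfl
  -- the integrands
  set f : ℝ × EuclideanSpace ℝ (Fin 3) → ℝ := fun z =>
    ⟪v z.1 z.2, convect (v z.1) (gradient (φ z.1)) z.2⟫ + π z.1 z.2 * Δ (φ z.1) z.2 with hf
  set g₁ : ℝ × EuclideanSpace ℝ (Fin 3) → ℝ := fun z => ⟪U z.1 z.2, H z (U z.1 z.2)⟫ with hg₁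
  set g₂ : ℝ × EuclideanSpace ℝ (Fin 3) → ℝ := fun z => P z.1 z.2 * Δ (φ z.1) z.2 with hg₂
  have hgind : (fun z => g₁ z + g₂ z) = S.indicator f := by
    funext z
    by_cases hz : z ∈ S
    · rw [indicator_of_mem hz]
      simp only [hg₁, hg₂, hf, hconv, hUin z.1 hz.1, hPin z.1 hz.1]
    · rw [indicator_of_notMem hz]
      have : z.1 ∉ Ioo 0 T := fun h' => hz ⟨h', mem_univ _⟩
      simp only [hg₁, hg₂, hUout z.1 this, hPout z.1 this, Pi.zero_apply, inner_zero_left, zero_mul,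
        add_zero]
  -- integrability
  have hIg₂ : Integrable g₂ volume :=
    integrable_mul_of_locallyIntegrableOn (Q := ⊤) (hPli.locallyIntegrableOn _) hcL hKc
      (fun _ _ => trivial) hLK
  have hIg₁ : Integrable g₁ volume := by
    have hUm : AEStronglyMeasurable (uncurry U) volume := hUli.aestronglyMeasurable
    have hm : AEStronglyMeasurable g₁ volume := by
      have h1 : AEStronglyMeasurable (fun z : ℝ × EuclideanSpace ℝ (Fin 3) => H z (uncurry U z)) volume :=
        isBoundedBilinearMap_apply.continuous.comp_aestronglyMeasurable (hcH.aestronglyMeasurable.prodMk hUm)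
      exact hUm.inner h1
    have hsupp : support g₁ ⊆ K := by
      intro z hz
      by_contra hzK
      exact hz (by simp only [hg₁, hH0 z hzK, zero_apply, inner_zero_right])
    refine (integrableOn_iff_integrable_of_support_subset hsupp).1 ?_
    have hI2K : IntegrableOn (fun z : ℝ × EuclideanSpace ℝ (Fin 3) => ‖uncurry U z‖ ^ 2) K volume :=
      hU2li.integrableOn_isCompact hKc
    refine Integrable.mono' (hI2K.const_mul CH) hm.restrict (ae_of_all _ fun z => ?_)
    simp only [hg₁]
    calc ‖⟪U z.1 z.2, H z (U z.1 z.2)⟫‖ ≤ ‖U z.1 z.2‖ * ‖H z (U z.1 z.2)‖ := norm_inner_le_norm _ _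
      _ ≤ ‖U z.1 z.2‖ * (‖H z‖ * ‖U z.1 z.2‖) := by
          gcongr; exact ContinuousLinearMap.le_opNorm _ _
      _ ≤ ‖U z.1 z.2‖ * (CH * ‖U z.1 z.2‖) := by gcongr; exact hCH z
      _ = CH * ‖uncurry U z‖ ^ 2 := by simp only [uncurry]; ring
  have hIg : Integrable (fun z => g₁ z + g₂ z) volume := hIg₁.add hIg₂
  have hIf : IntegrableOn f S volume :=
    (hIg.integrableOn : IntegrableOn (fun z => g₁ z + g₂ z) S volume).congr_fun (fun z hz => by
      rw [hgind, indicator_of_mem hz]) hSm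
  -- the identity on the slab, by exhaustion
  have hns := h.distributional
  have hf₁ : LocallyIntegrableOn (uncurry (0 : ℝ → EuclideanSpace ℝ (Fin 3) → EuclideanSpace ℝ (Fin 3)))
      ((slab (EuclideanSpace ℝ (Fin 3)) (Ioo 0 T) isOpen_Ioo : Opens (ℝ × EuclideanSpace ℝ (Fin 3))) :
        Set (ℝ × EuclideanSpace ℝ (Fin 3))) volume := locallyIntegrableOn_zero
  have hdivf : ∀ θ : ℝ → EuclideanSpace ℝ (Fin 3) → ℝ,
      IsSpaceTimeTestOn (slab (EuclideanSpace ℝ (Fin 3)) (Ioo 0 T) isOpen_Ioo) θ →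
      ∫ t, ∫ x, ⟪(0 : ℝ → EuclideanSpace ℝ (Fin 3) → EuclideanSpace ℝ (Fin 3)) t x, gradient (θ t) x⟫ = 0 := by
    intro θ _
    simp only [Pi.zero_apply, inner_zero_left, integral_zero]
  have hzero : ∫ z in S, f z = 0 := by
    refine setIntegral_slab_eq_zero_of_forall_time_cutoff hT hIf fun η hηs _ hηsupp => ?_
    have hψ := isSpaceTimeTestOn_slab_time_mul hφ hηs hηsupp
    have key := hns.integral_hessian_add_pressure_laplacian_eq_zero_of_iterated hf₁ hdivf hψ
    -- derivatives of the product
    have hd : ∀ t x, DifferentiableAt ℝ (φ t) x := fun t x =>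
      ((hφ.contDiff_slice t).differentiable (by simp)).differentiableAt
    have hd2 : ∀ t x, DifferentiableAt ℝ (fderiv ℝ (φ t)) x := fun t x =>
      (((hφ2 t).fderiv_right (m := 1) le_rfl).differentiable one_ne_zero) x
    have h2d : ∀ t x (u : EuclideanSpace ℝ (Fin 3)),
        fderiv ℝ (fderiv ℝ (fun x => η t * φ t x)) x u u = η t * fderiv ℝ (fderiv ℝ (φ t)) x u u := by
      intro t x u
      have e1 : fderiv ℝ (fun x => η t * φ t x) = η t • fderiv ℝ (φ t) := by
        funext y; rw [Pi.smul_apply]; exact fderiv_const_mul (hd t y) _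
      rw [e1, fderiv_const_smul (hd2 t x)]
      simp only [FunLike.coe_smul, Pi.smul_apply, smul_eq_mul]
    have hLap : ∀ t x, Δ ((fun t x => η t * φ t x) t) x = η t * Δ (φ t) x := by
      intro t x
      have e : (fun x => η t * φ t x) = (η t) • (φ t) := by
        funext y; simp only [Pi.smul_apply, smul_eq_mul]
      show Δ (fun x => η t * φ t x) x = _
      rw [e, InnerProductSpace.laplacian_smul _ ((hφ2 t).contDiffAt), smul_eq_mul]
    refine Eq.trans (setIntegral_congr_fun hSm fun z _ => ?_) key
    show η z.1 * f z = fderiv ℝ (fderiv ℝ ((fun t x => η t * φ t x) z.1)) z.2 (v z.1 z.2) (v z.1 z.2) +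
      π z.1 z.2 * Δ ((fun t x => η t * φ t x) z.1) z.2
    rw [hLap, h2d]
    simp only [hf, convect, inner_fderiv_gradient_apply (hφ2 z.1)]
    ring
  calc ∫ z : ℝ × EuclideanSpace ℝ (Fin 3), (⟪U z.1 z.2, convect (U z.1) (gradient (φ z.1)) z.2⟫ + P z.1 z.2 * Δ (φ z.1) z.2)
      = ∫ z, (g₁ z + g₂ z) := by simp only [hg₁, hg₂, hconv]
    _ = ∫ z, S.indicator f z := by rw [hgind]
    _ = ∫ z in S, f z := integral_indicator hSm
    _ = 0 := hzero

end Identities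

/-! ### The local energy inequality of the zero extension, with the datum term -/

section DatumLEI

variable {T ν : ℝ} {v₀ : EuclideanSpace ℝ (Fin 3) → EuclideanSpace ℝ (Fin 3)}
  {v U : ℝ → EuclideanSpace ℝ (Fin 3) → EuclideanSpace ℝ (Fin 3)}
  {π P : ℝ → EuclideanSpace ℝ (Fin 3) → ℝ}
  {G Gt : ℝ → EuclideanSpace ℝ (Fin 3) → EuclideanSpace ℝ (Fin 3) →L[ℝ] EuclideanSpace ℝ (Fin 3)}

/-- **The local energy inequality of the zero extension, with the datum term** (Seregin 2014,
Remark B.3, (B.1.10) from `t₀ = 0`, i.e. the accepted `IsLocalEnergySolutionOn.localEnergyIneq_initial`,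
rewritten for the extensions `U, P, G̃` by zero outside `(0, T)`): for every nonnegative space–time
test `φ` supported in `{t < T}`,
`2ν ∫∫ |G̃|² φ ≤ ∫ |v₀|² φ(0,·) + ∫∫ (|U|²(φₜ + νΔφ) + (|U|² + 2P) U·∇φ)` (iterated integrals over
all of `ℝ × ℝ³`). [cite: Seregin2014, Remark B.3 (B.1.10)] -/
theorem localEnergyIneq_datum_extension (h : IsLocalEnergySolutionOn T ν v₀ v π) (hT : 0 < T)
    (hm₀ : AEStronglyMeasurable v₀ volume)
    (hG : HasWeakSpatialGradientOn (slab (EuclideanSpace ℝ (Fin 3)) (Ioo 0 T) isOpen_Ioo) v G)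
    (hGb : ∀ R : ℝ, 0 < R → ∃ C : ℝ≥0, ∀ x₀ : EuclideanSpace ℝ (Fin 3),
      ∫⁻ z in Ioo 0 T ×ˢ ball x₀ R, ENNReal.ofReal (frobeniusNormSq (G z.1 z.2)) ≤ C)
    (hUin : ∀ t ∈ Ioo 0 T, U t = v t) (hUout : ∀ t, t ∉ Ioo 0 T → U t = 0)
    (hPin : ∀ t ∈ Ioo 0 T, P t = π t) (hPout : ∀ t, t ∉ Ioo 0 T → P t = 0)
    (hGin : ∀ t ∈ Ioo 0 T, Gt t = G t) (hGout : ∀ t, t ∉ Ioo 0 T → Gt t = 0)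
    {φ : ℝ → EuclideanSpace ℝ (Fin 3) → ℝ}
    (hφ : IsSpaceTimeTestOn (slab (EuclideanSpace ℝ (Fin 3)) (Iio T) isOpen_Iio) φ)
    (hφ0 : ∀ t x, 0 ≤ φ t x) :
    2 * ν * ∫ t, ∫ x, frobeniusNormSq (Gt t x) * φ t x ≤
      (∫ x, ‖v₀ x‖ ^ 2 * φ 0 x) +
        ∫ t, ∫ x, (‖U t x‖ ^ 2 * (timeDeriv φ t x + ν * Δ (φ t) x) +
          (‖U t x‖ ^ 2 + 2 * P t x) * ⟪U t x, gradient (φ t) x⟫) := by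
  set S : Set (ℝ × EuclideanSpace ℝ (Fin 3)) := Ioo 0 T ×ˢ (univ : Set (EuclideanSpace ℝ (Fin 3))) with hS
  have hSm : MeasurableSet S := measurableSet_Ioo.prod MeasurableSet.univ
  have hφ' : IsSpaceTimeTestOn (⊤ : Opens (ℝ × EuclideanSpace ℝ (Fin 3))) φ := hφ.mono le_top
  have key := h.localEnergyIneq_initial hT hm₀ hG hφ hφ0
  -- the dissipation side
  set F : ℝ × EuclideanSpace ℝ (Fin 3) → ℝ := fun z => frobeniusNormSq (G z.1 z.2) * φ z.1 z.2 with hF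
  have hFext : (fun z : ℝ × EuclideanSpace ℝ (Fin 3) => frobeniusNormSq (Gt z.1 z.2) * φ z.1 z.2) = S.indicator F := by
    funext z
    by_cases hz : z ∈ S
    · rw [indicator_of_mem hz]; simp only [hF, hGin z.1 hz.1]
    · rw [indicator_of_notMem hz]
      have : z.1 ∉ Ioo 0 T := fun h' => hz ⟨h', mem_univ _⟩
      simp only [hGout z.1 this, Pi.zero_apply, frobeniusNormSq_zero, zero_mul]
  have hIF : IntegrableOn F S volume := integrableOn_frobeniusNormSq_mul_slab hG hGb hφ'
  have hL : ∫ t, ∫ x, frobeniusNormSq (Gt t x) * φ t x = ∫ z in S, F z := by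
    rw [show (fun t => ∫ x, frobeniusNormSq (Gt t x) * φ t x) = fun t => ∫ x, S.indicator F (t, x) by
      funext t; refine integral_congr_ae (Eventually.of_forall fun x => ?_); exact congrFun hFext (t, x)]
    exact integral_integral_indicator_slab ((integrable_indicator_iff hSm).2 hIF)
  -- the right-hand side
  set R : ℝ × EuclideanSpace ℝ (Fin 3) → ℝ := localEnergyRHS ν 0 v π φ with hR
  have hRext : (fun z : ℝ × EuclideanSpace ℝ (Fin 3) =>
      ‖U z.1 z.2‖ ^ 2 * (timeDeriv φ z.1 z.2 + ν * Δ (φ z.1) z.2) +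
        (‖U z.1 z.2‖ ^ 2 + 2 * P z.1 z.2) * ⟪U z.1 z.2, gradient (φ z.1) z.2⟫) = S.indicator R := by
    funext z
    by_cases hz : z ∈ S
    · rw [indicator_of_mem hz]
      simp only [hR, localEnergyRHS, hUin z.1 hz.1, hPin z.1 hz.1, Pi.zero_apply, inner_zero_left,
        zero_mul, mul_zero, add_zero]
    · rw [indicator_of_notMem hz]
      have : z.1 ∉ Ioo 0 T := fun h' => hz ⟨h', mem_univ _⟩
      simp only [hUout z.1 this, hPout z.1 this, Pi.zero_apply, norm_zero, inner_zero_left, mul_zero,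
        add_zero]
      ring
  have hIR : IntegrableOn R S volume := h.integrableOn_localEnergyRHS_slab hφ'
  have hRhs : ∫ t, ∫ x, (‖U t x‖ ^ 2 * (timeDeriv φ t x + ν * Δ (φ t) x) +
      (‖U t x‖ ^ 2 + 2 * P t x) * ⟪U t x, gradient (φ t) x⟫) = ∫ z in S, R z := by
    rw [show (fun t => ∫ x, (‖U t x‖ ^ 2 * (timeDeriv φ t x + ν * Δ (φ t) x) +
        (‖U t x‖ ^ 2 + 2 * P t x) * ⟪U t x, gradient (φ t) x⟫)) = fun t => ∫ x, S.indicator R (t, x) by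
      funext t; refine integral_congr_ae (Eventually.of_forall fun x => ?_); exact congrFun hRext (t, x)]
    exact integral_integral_indicator_slab ((integrable_indicator_iff hSm).2 hIR)
  rw [hL, hRhs]
  exact key

end DatumLEI

/-! ### The classes of the zero extension on cylinders -/

section CylinderClasses

variable {T ν : ℝ} {v₀ : EuclideanSpace ℝ (Fin 3) → EuclideanSpace ℝ (Fin 3)}
  {v U : ℝ → EuclideanSpace ℝ (Fin 3) → EuclideanSpace ℝ (Fin 3)}
  {π P : ℝ → EuclideanSpace ℝ (Fin 3) → ℝ}
  {G Gt : ℝ → EuclideanSpace ℝ (Fin 3) → EuclideanSpace ℝ (Fin 3) →L[ℝ] EuclideanSpace ℝ (Fin 3)}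

/-- **The zero-extended gradient is square integrable on every unit cylinder**:
`∫∫_{Q_1(z₀)} |G̃|² ≤ ∫∫_{(0,T) × B_1(x₀)} |G|² < ∞`. [folklore] -/
theorem lintegral_cylinder_frobeniusNormSq_extension_lt_top
    (hGb : ∀ R : ℝ, 0 < R → ∃ C : ℝ≥0, ∀ x₀ : EuclideanSpace ℝ (Fin 3),
      ∫⁻ z in Ioo 0 T ×ˢ ball x₀ R, ENNReal.ofReal (frobeniusNormSq (G z.1 z.2)) ≤ C)
    (hGin : ∀ t ∈ Ioo 0 T, Gt t = G t) (hGout : ∀ t, t ∉ Ioo 0 T → Gt t = 0)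
    (z₀ : ℝ × EuclideanSpace ℝ (Fin 3)) :
    ∫⁻ w in parabolicCylinder 1 z₀, ENNReal.ofReal (frobeniusNormSq (Gt w.1 w.2)) < ∞ := by
  set S : Set (ℝ × EuclideanSpace ℝ (Fin 3)) := Ioo 0 T ×ˢ (univ : Set (EuclideanSpace ℝ (Fin 3))) with hS
  have hSm : MeasurableSet S := measurableSet_Ioo.prod MeasurableSet.univ
  obtain ⟨C, hC⟩ := hGb 1 one_pos
  have e : (fun w : ℝ × EuclideanSpace ℝ (Fin 3) => ENNReal.ofReal (frobeniusNormSq (Gt w.1 w.2))) =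
      S.indicator fun w => ENNReal.ofReal (frobeniusNormSq (G w.1 w.2)) := by
    funext w
    by_cases hw : w ∈ S
    · rw [indicator_of_mem hw, hGin w.1 hw.1]
    · rw [indicator_of_notMem hw]
      have : w.1 ∉ Ioo 0 T := fun h' => hw ⟨h', mem_univ _⟩
      rw [hGout w.1 this, Pi.zero_apply, frobeniusNormSq_zero, ENNReal.ofReal_zero]
  rw [e, lintegral_indicator hSm, Measure.restrict_restrict hSm]
  have hsub : S ∩ parabolicCylinder 1 z₀ ⊆ Ioo 0 T ×ˢ ball z₀.2 1 := fun w hw =>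
    ⟨hw.1.1, (mem_parabolicCylinder.1 hw.2).2⟩
  exact lt_of_le_of_lt (lintegral_mono_set hsub) ((hC z₀.2).trans_lt ENNReal.coe_lt_top)

/-- **The zero-extended pressure is in `L^{3/2}` on every unit cylinder**:
`∫∫_{Q_1(z₀)} |P|^{3/2} ≤ ∫∫_{(0,T) × B̄_1(x₀)} |π|^{3/2} < ∞`. [folklore] -/
theorem lintegral_cylinder_pressure_extension_lt_top (h : IsLocalEnergySolutionOn T ν v₀ v π)
    (hPin : ∀ t ∈ Ioo 0 T, P t = π t) (hPout : ∀ t, t ∉ Ioo 0 T → P t = 0)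
    (z₀ : ℝ × EuclideanSpace ℝ (Fin 3)) :
    ∫⁻ w in parabolicCylinder 1 z₀, ‖P w.1 w.2‖ₑ ^ (3 / 2 : ℝ) < ∞ := by
  set S : Set (ℝ × EuclideanSpace ℝ (Fin 3)) := Ioo 0 T ×ˢ (univ : Set (EuclideanSpace ℝ (Fin 3))) with hS
  have hSm : MeasurableSet S := measurableSet_Ioo.prod MeasurableSet.univ
  have e : (fun w : ℝ × EuclideanSpace ℝ (Fin 3) => ‖P w.1 w.2‖ₑ ^ (3 / 2 : ℝ)) =
      S.indicator fun w => ‖π w.1 w.2‖ₑ ^ (3 / 2 : ℝ) := by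
    funext w
    by_cases hw : w ∈ S
    · rw [indicator_of_mem hw, hPin w.1 hw.1]
    · rw [indicator_of_notMem hw]
      have : w.1 ∉ Ioo 0 T := fun h' => hw ⟨h', mem_univ _⟩
      rw [hPout w.1 this, Pi.zero_apply, enorm_zero, ENNReal.zero_rpow_of_pos (by norm_num)]
  rw [e, lintegral_indicator hSm, Measure.restrict_restrict hSm]
  have hsub : S ∩ parabolicCylinder 1 z₀ ⊆ Ioo 0 T ×ˢ closedBall z₀.2 1 := fun w hw =>
    ⟨hw.1.1, ball_subset_closedBall (mem_parabolicCylinder.1 hw.2).2⟩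
  exact lt_of_le_of_lt (lintegral_mono_set hsub) (h.pressure _ (isCompact_closedBall _ _))

/-- The zero-extended pressure is locally integrable on every open space–time region. [folklore] -/
theorem locallyIntegrableOn_pressure_extension (h : IsLocalEnergySolutionOn T ν v₀ v π)
    (hPin : ∀ t ∈ Ioo 0 T, P t = π t) (hPout : ∀ t, t ∉ Ioo 0 T → P t = 0)
    (Ω : Set (ℝ × EuclideanSpace ℝ (Fin 3))) :
    LocallyIntegrableOn (uncurry P) Ω volume := by
  rw [uncurry_eq_indicator_slab hPin hPout]
  exact locallyIntegrableOn_indicator_slab (fun K hK => h.integrableOn_pressure hK) Ω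

end CylinderClasses

end BarkerPrange2020

end Literature.Analysis.FluidPDE

end
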